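import Summits.Ventures.PercRepro.Night2OneFatCaseOneTypes

/-!
# PercRepro — the seven-point shape (i): the COUPLING COUNTS (night-2, gen 30)

The two sides of a shape-(i) target classify the outside points `X = G ∖ S` by membership in `H` and in the three
face closures `A₁, A₂, A₃` of side `1` (`typeCount`, Night2OneFatCaseOneTypes), resp. `B₁, B₂, B₃` of side `2`.
With the closure property on each side and the two cross facts (G1: a point of `H` in all three `B` is in no `A`,
and symmetrically; G3: no point is in all six), the counts of the finite check (Night2ShapeOneCheck) are related:
`fE₁ = e1o + eb01`, `eb = eb01 + a₁ + a₂ + a₃` (and the mirror), `nZ = ζ₁ + zA₁ ≤ ζ₁ + ζ₂`, and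
`|X| = e1o + e2o + eb + nZ` (proofs/NIGHT-2-g30.md §4 (c1)–(c4)) — pure counting over `Finset.filter`.
-/

namespace PercRepro.Shadow

open Finset

section Counts

variable {α : Type*} [DecidableEq α] {X : Finset α} {H A₁ A₂ A₃ B₁ B₂ B₃ : α → Prop}
  [DecidablePred H] [DecidablePred A₁] [DecidablePred A₂] [DecidablePred A₃]
  [DecidablePred B₁] [DecidablePred B₂] [DecidablePred B₃]

omit [DecidableEq α] in
/-- The points of `X` in `H` and in none of the `A` (the free points of side `1` in `H`). -/
theorem typeCount_free_eq : typeCount X H A₁ A₂ A₃ true false false false =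
    (X.filter (fun x => H x ∧ ¬ A₁ x ∧ ¬ A₂ x ∧ ¬ A₃ x)).card := by
  unfold typeCount
  congr 1
  ext x
  simp only [Finset.mem_filter, decide_eq_true_eq, decide_eq_false_iff_not]

omit [DecidableEq α] in
/-- The points of `X` in `H` and in all three `A`. -/
theorem typeCount_all_eq : typeCount X H A₁ A₂ A₃ true true true true =
    (X.filter (fun x => H x ∧ A₁ x ∧ A₂ x ∧ A₃ x)).card := by
  unfold typeCount
  congr 1
  ext x
  simp only [Finset.mem_filter, decide_eq_true_eq]

omit [DecidableEq α] in
/-- The points of `X` off `H` and in all three `A`. -/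
theorem typeCount_zA_eq : typeCount X H A₁ A₂ A₃ false true true true =
    (X.filter (fun x => ¬ H x ∧ A₁ x ∧ A₂ x ∧ A₃ x)).card := by
  unfold typeCount
  congr 1
  ext x
  simp only [Finset.mem_filter, decide_eq_true_eq, decide_eq_false_iff_not]

omit [DecidableEq α] in
/-- **(C1)** `fE₁ = e1o + eb01`: the free points of side `1` in `H` are those in all three `B` (on the other line) and
the others; a point of `H` in all three `B` is in no `A` (G1). -/
theorem card_free_eq_other_add
    (hG1 : ∀ x ∈ X, H x → B₁ x → B₂ x → B₃ x → ¬ A₁ x ∧ ¬ A₂ x ∧ ¬ A₃ x) :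
    typeCount X H A₁ A₂ A₃ true false false false =
      typeCount X H B₁ B₂ B₃ true true true true +
      (X.filter (fun x => H x ∧ (¬ A₁ x ∧ ¬ A₂ x ∧ ¬ A₃ x) ∧ ¬ (B₁ x ∧ B₂ x ∧ B₃ x))).card := by
  rw [typeCount_free_eq, typeCount_all_eq]
  rw [card_filter_split (fun x => H x ∧ ¬ A₁ x ∧ ¬ A₂ x ∧ ¬ A₃ x) (fun x => B₁ x ∧ B₂ x ∧ B₃ x)]
  congr 1
  · congr 1
    ext x
    simp only [Finset.mem_filter]
    constructor
    · rintro ⟨hx, ⟨hH, -⟩, hB⟩; exact ⟨hx, hH, hB⟩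
    · rintro ⟨hx, hH, hB⟩
      exact ⟨hx, ⟨hH, hG1 x hx hH hB.1 hB.2.1 hB.2.2⟩, hB⟩
  · congr 1
    ext x
    simp only [Finset.mem_filter]
    tauto

/-- **(C2)** `eb = eb01 + a₁ + a₂ + a₃`: the points of `H` visible on both sides are the free ones of side `1` and the
ones attached to exactly one `A` (closure property; an attached point is visible on side `2` by G1). -/
theorem card_both_eq (hA : ClosureProp A₁ A₂ A₃)
    (hG1 : ∀ x ∈ X, H x → B₁ x → B₂ x → B₃ x → ¬ A₁ x ∧ ¬ A₂ x ∧ ¬ A₃ x) :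
    (X.filter (fun x => H x ∧ ¬ (A₁ x ∧ A₂ x ∧ A₃ x) ∧ ¬ (B₁ x ∧ B₂ x ∧ B₃ x))).card =
      (X.filter (fun x => H x ∧ (¬ A₁ x ∧ ¬ A₂ x ∧ ¬ A₃ x) ∧ ¬ (B₁ x ∧ B₂ x ∧ B₃ x))).card +
      (typeCount X H A₁ A₂ A₃ true true false false + typeCount X H A₁ A₂ A₃ true false true false +
        typeCount X H A₁ A₂ A₃ true false false true) := by
  unfold typeCount
  have hcover : X.filter (fun x => H x ∧ ¬ (A₁ x ∧ A₂ x ∧ A₃ x) ∧ ¬ (B₁ x ∧ B₂ x ∧ B₃ x)) =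
      (X.filter (fun x => H x ∧ (¬ A₁ x ∧ ¬ A₂ x ∧ ¬ A₃ x) ∧ ¬ (B₁ x ∧ B₂ x ∧ B₃ x))) ∪
      ((X.filter (fun x => decide (H x) = true ∧ decide (A₁ x) = true ∧ decide (A₂ x) = false ∧ decide (A₃ x) = false)) ∪
      ((X.filter (fun x => decide (H x) = true ∧ decide (A₁ x) = false ∧ decide (A₂ x) = true ∧ decide (A₃ x) = false)) ∪
      (X.filter (fun x => decide (H x) = true ∧ decide (A₁ x) = false ∧ decide (A₂ x) = false ∧ decide (A₃ x) = true)))) := by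
    ext x
    simp only [Finset.mem_filter, Finset.mem_union, decide_eq_false_iff_not, decide_eq_true_eq]
    constructor
    · rintro ⟨hx, hH, hnA, hnB⟩
      by_cases h1 : A₁ x <;> by_cases h2 : A₂ x <;> by_cases h3 : A₃ x
      · exact absurd ⟨h1, h2, h3⟩ hnA
      · exact absurd (hA.2.2 x h1 h2) h3
      · exact absurd (hA.2.1 x h1 h3) h2
      · exact Or.inr (Or.inl ⟨hx, hH, h1, h2, h3⟩)
      · exact absurd (hA.1 x h2 h3) h1
      · exact Or.inr (Or.inr (Or.inl ⟨hx, hH, h1, h2, h3⟩))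
      · exact Or.inr (Or.inr (Or.inr ⟨hx, hH, h1, h2, h3⟩))
      · exact Or.inl ⟨hx, hH, ⟨h1, h2, h3⟩, hnB⟩
    · rintro (h | h | h | h)
      · exact ⟨h.1, h.2.1, fun hall => h.2.2.1.1 hall.1, h.2.2.2⟩
      · refine ⟨h.1, h.2.1, fun hall => h.2.2.2.1 hall.2.1, fun hB => ?_⟩
        exact (hG1 x h.1 h.2.1 hB.1 hB.2.1 hB.2.2).1 h.2.2.1
      · refine ⟨h.1, h.2.1, fun hall => h.2.2.1 hall.1, fun hB => ?_⟩
        exact (hG1 x h.1 h.2.1 hB.1 hB.2.1 hB.2.2).2.1 h.2.2.2.1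
      · refine ⟨h.1, h.2.1, fun hall => h.2.2.1 hall.1, fun hB => ?_⟩
        exact (hG1 x h.1 h.2.1 hB.1 hB.2.1 hB.2.2).2.2 h.2.2.2.2
  rw [hcover]
  repeat rw [Finset.card_union_of_disjoint]
  · omega
  all_goals
    rw [Finset.disjoint_left]
    intro x hx hx'
    simp only [Finset.mem_filter, Finset.mem_union, decide_eq_false_iff_not, decide_eq_true_eq] at hx hx'
    simp_all

/-- **(C6)** The points off `H` in all three `A` are off at least one `B` (G3): `zA₁ ≤ ζ₂`. -/
theorem card_zA_le_zeta (hB : ClosureProp B₁ B₂ B₃)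
    (hG3 : ∀ x ∈ X, A₁ x → A₂ x → A₃ x → B₁ x → B₂ x → B₃ x → False) :
    typeCount X H A₁ A₂ A₃ false true true true ≤
      typeCount X H B₁ B₂ B₃ false false false false + typeCount X H B₁ B₂ B₃ false true false false +
        typeCount X H B₁ B₂ B₃ false false true false + typeCount X H B₁ B₂ B₃ false false false true := by
  have h1 := card_not_H (X := X) (H := H) hB
  rw [typeCount_zA_eq (A₁ := B₁) (A₂ := B₂) (A₃ := B₃)] at h1
  rw [typeCount_zA_eq]
  rw [card_filter_split (fun x => ¬ H x) (fun x => B₁ x ∧ B₂ x ∧ B₃ x)] at h1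
  have hle : (X.filter (fun x => ¬ H x ∧ A₁ x ∧ A₂ x ∧ A₃ x)).card ≤
      (X.filter (fun x => ¬ H x ∧ ¬ (B₁ x ∧ B₂ x ∧ B₃ x))).card := by
    apply Finset.card_le_card
    intro x hx
    rw [Finset.mem_filter] at hx ⊢
    exact ⟨hx.1, hx.2.1, fun hB => hG3 x hx.1 hx.2.2.1 hx.2.2.2.1 hx.2.2.2.2 hB.1 hB.2.1 hB.2.2⟩
  omega

omit [DecidableEq α] in
/-- **(C7)** `|X| = e1o + e2o + eb + nZ`: the points of `H` are those in all three `B`, those in all three `A`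
(disjoint classes by G3) and the rest. -/
theorem card_eq_sum_classes
    (hG3 : ∀ x ∈ X, A₁ x → A₂ x → A₃ x → B₁ x → B₂ x → B₃ x → False) :
    X.card = typeCount X H B₁ B₂ B₃ true true true true + typeCount X H A₁ A₂ A₃ true true true true +
      (X.filter (fun x => H x ∧ ¬ (A₁ x ∧ A₂ x ∧ A₃ x) ∧ ¬ (B₁ x ∧ B₂ x ∧ B₃ x))).card +
      (X.filter (fun x => ¬ H x)).card := by
  rw [typeCount_all_eq, typeCount_all_eq]
  have h0 : X.card = (X.filter (fun x => H x)).card + (X.filter (fun x => ¬ H x)).card :=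
    (Finset.card_filter_add_card_filter_not (fun x => H x)).symm
  have h1 := card_filter_split (fun x => H x) (fun x => B₁ x ∧ B₂ x ∧ B₃ x) X
  have h2 := card_filter_split (fun x => H x ∧ ¬ (B₁ x ∧ B₂ x ∧ B₃ x)) (fun x => A₁ x ∧ A₂ x ∧ A₃ x) X
  have h3 : (X.filter (fun x => (H x ∧ ¬ (B₁ x ∧ B₂ x ∧ B₃ x)) ∧ A₁ x ∧ A₂ x ∧ A₃ x)).card =
      (X.filter (fun x => H x ∧ A₁ x ∧ A₂ x ∧ A₃ x)).card := by
    congr 1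
    ext x
    simp only [Finset.mem_filter]
    constructor
    · rintro ⟨hx, ⟨hH, -⟩, hA⟩; exact ⟨hx, hH, hA⟩
    · rintro ⟨hx, hH, hA⟩
      exact ⟨hx, ⟨hH, fun hB => hG3 x hx hA.1 hA.2.1 hA.2.2 hB.1 hB.2.1 hB.2.2⟩, hA⟩
  have h4 : (X.filter (fun x => (H x ∧ ¬ (B₁ x ∧ B₂ x ∧ B₃ x)) ∧ ¬ (A₁ x ∧ A₂ x ∧ A₃ x))).card =
      (X.filter (fun x => H x ∧ ¬ (A₁ x ∧ A₂ x ∧ A₃ x) ∧ ¬ (B₁ x ∧ B₂ x ∧ B₃ x))).card := by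
    congr 1
    ext x
    simp only [Finset.mem_filter]
    tauto
  omega

end Counts

end PercRepro.Shadow
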